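import Literature.IUT.LogVolume.TensorPacketStepV
import Literature.IUT.LogVolume.TensorPacketLogHolds
import HarnessLib

/-!
# The fork at [IUTchIII] Corollary 3.12 — the PER-PACKET readings at ONE REAL prime packet (skeleton XXVI)

Record-only file (D-0012) of the abc-iut cell (deliverable (a), skeleton seat abc-iut-skel, gen 6); TAKES NO
SIDE. This is the M-level sequel of skeleton XXIV (`ForkLocalGlobal`, p412157) / XXIVc (`ForkLocalGlobalNumbers`,
p413110) announced in `HOME/skel/FORK-LOCAL-GLOBAL.md` §6. There the finding was: every SUFFICIENT reading of
[IUTchIII] Cor. 3.12 Step (xi) typed in the tree except R1 is PER PACKET — R0 `qLocal ≤ thetaLocal`, R2 `q-region ⊆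
Θ-hull`, R3 `q-region is a possible image`, R4 (Yamashita's containment up to isomorphism), Team B's
`VolumeTransport` — while the print compares two GLOBAL real numbers ((xi-f)/(xi-g) p. 184) and Step (xii)
(p. 185 l. 59 – p. 186 l. 3) disclaims per-place log-volume computations; and per-packet readings were ARGUED
(printed-shape arithmetic, kernel-checked only in the coefficient shadow XXIVc) to be false in the intended model
at deep bad places. HERE the argument is a THEOREM about a REAL packet of the tree, with nothing typed by hand:

* the packet is abc-iut-c312-3's `realPrimePacket p 𝔽` (`TensorPacketModel.lean`): summands
  `X_{v⃗} = K_{v̲_0} ⊗_{ℚ_p} ⋯ ⊗_{ℚ_p} K_{v̲_j}` over Mathlib-class local fields, `O_{v⃗} = (R_I)^∼`, the normalised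
  log Haar measure `packetLogμ`, admissibility `PacketAdm`, the genuine (Ind1) factor permutations `perm σ` and
  (Ind2) group `G₂ = Aut_{ℚ_p}(V : log_p(R_I^×))`, the genuine hull `packetHull` (Dupuy–Hilado Def. 3.6.1, §3.7,
  §4.7, §4.9, §4.12);
* the Θ-side UPPER bound is abc-iut-c312-d1's **`realPrimePacket_stepV`** ([IUTchIV] Thm. 1.10 proof Step (v)
  pp. 27–28, per summand, in the real packet; p411230) with its one hypothesis [IUTchIV] Prop. 1.2 (ii)
  DISCHARGED by abc-iut-S6's `prop12ii_holds` (`TensorPacketLogHolds.lean`, from abc-iut-S5's Prop. 1.1): the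
  hull of the local (Ind2)·(Ind1)-orbit of sharp (Ind3)-data `B` around the theta values `t_v` has
  `log μ̄ ≤ log‖t_{v_{i₀}}‖ + {d_I + 1}·log(p) + Σ_{i∈I*}{3 + log(e_i)}` (`i₀` a slot of largest norm);
* the q-side is EXACT: the q-pilot region at `v⃗` is the arithmetic-line-bundle region `ι_j(q̲)·O_{v⃗}` ([IUTchIII]
  Rmk. 3.9.5 (ix) (cQ3); Dupuy–Hilado §3.4 `O_𝕃(−P_q)`, §3.9 twist through the last factor) with
  `log μ̄ = log‖q̲‖` (abc-iut-S2/S8 `packetLogμ_iota_smul_normalizedPacket`, Dupuy–Hilado (3.7) with (3.4)).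

PROVED (`PacketReal.*`): `logμ_pilotRegion`, `adm_pilotRegion`; `thetaHull_bound` (Step (v) unconditional);
**`not_volumeReading_of_deep`** — as soon as `log‖t_{v_{i₀}}‖ + {d_I + 1}·log(p) + Σ_{i∈I*}{3 + log(e_i)} < log‖q̲‖`
(the q-value at `v⃗`'s last place is shallower than the shallowest theta value among the slots by more than the
[IUTchIV] Prop. 1.4 discrepancy) the volume reading R0 FAILS at `v⃗`, for EVERY sharp (Ind3)-datum and its whole
(Ind1)·(Ind2)-orbit; hence (`not_subsetReading_of_deep`, `not_memReading_of_deep`, `not_isoReading_of_deep`,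
`not_isoVolReading_of_deep`) the set-level readings R2, R3 and the iso-containment readings R4/R4′ (the tree's
`Cor312Vol.IsoContainment` shape) fail there too (monotonicity of `log μ̄`; (Ind2)
preserves `log μ̄` — DH §4.9 "the measure of sets are preserved", a THEOREM of the model). The printed Θ-weights
make the hypothesis generic: `not_volumeReading_thetaWeights` — on the diagonal summand `v⃗ = (v,…,v)` with theta
value `t_v`, `‖t_v‖ = ‖q̲‖^{j²}` ([IUTchI] Ex. 3.2 (iv) `q̲_v`; [IUTchIV] Step (v) p. 28 weight `j²` — per element "`− j²/(2l(j+1))·log(q_v)`",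
after the weighted average "`− j²/2l·log(q_{v_ℚ})`"; SS 2018
§2.1.8), R0 fails as soon as `(j² − 1)·(−log‖q̲‖) > {d_I + 1}·log(p) + (j+1)·{3 + log(e)}` — at the top label
`j = l⋇` this is `((l⋇)² − 1)·ord(q̲_v)·log(p)/e_v > …`, i.e. for every bad place of positive `q̲`-order once `l`
is in the range [IUTchIV] Cor. 2.2 uses, not only at "deep" places; NON-VACUITY
`thetaWeights_hypotheses_satisfiable`: at every place and every `j ≥ 2` the hypotheses are jointly satisfiable
in the real packet (`t := p^{N·j²}`, `q̲ := p^N`, `B :=` the bare regions, `N` large), so the readings are REFUTED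
at explicit data of every real packet, not merely underivable.

WHAT THIS IS AND IS NOT. It is a theorem about the REAL packet model and the READINGS at the level of ONE
SUMMAND `v⃗ ∈ 𝕍_p^{j+1}` of the `(j, v_ℚ = p)`-packet (the `v⃗`-component of Dupuy–Hilado Def. 3.6.1 / [IUTchIII]
Prop. 3.1 (i)). The per-PACKET readings typed in the tree (our R0/R2/R3/R4: c312-7
`Cor312Vol.statement_of_qLocal_le` / `_of_qRegion_subset_thetaHull` / `_of_qRegion_mem_possibleImages`,
`Cor312ReadingIso`; Team B `VolumeTransport`) compare, at `(j, p)`, the WEIGHTED SUMS over the summands `v⃗` of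
exactly these summand quantities ([IUTchIII] Rmk. 3.1.1 (ii) weights); when `𝕍` has ONE element over `p` — always
the case for `F_mod = ℚ`, since `𝕍 ⥲ 𝕍_mod` ([IUTchI] Def. 3.1 (e)) — the `(j, p)`-packet IS the diagonal summand
`(v, …, v)` and the summand readings here ARE the per-packet readings at `(j, p)` (one summand, positive weight);
with several places over `p` the packet reading is a weighted sum of summand comparisons of BOTH signs (at a
summand with a unit theta slot the Θ-hull bound is `≥ 0 >` the q-volume) and is not settled here. Everything is
under c312-d1's SHARP reading of (Ind3) (`B_σ ⊆ t·O`; plan/D9PRIME O4) — with Dupuy–Hilado's log-shell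
enlargement the discrepancy gains the log-shell index and the shape is unchanged. It says NOTHING about the
printed GLOBAL inequality of Cor. 3.12
(`Cor312.Setting.Statement`: procession-normalised, `v_ℚ`-summed), which the same arithmetic leaves open exactly
as [IUTchIV] Thm. 1.10 does (XXIVc `GlobalShadow.global_of_compensation`): per-packet deficits at bad places are
set against the log-different/conductor terms of all places. The lift of this packet statement to the assembled
setting `Cor312.Setting.ofComparison` (c312-6 `qLocal_ofFrames`/`thetaLocal_ofFrames_of_hull_eq`) is bookkeeping
left to the A-0/B-2 bridge owners. Sources read on the page: [IUTchIII] kurims `paper:url-4b091feeb646` pp. 127,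
173–174, 183–186; [IUTchIV] kurims `paper:url-56bcb0f95768` pp. 10, 27–29; Dupuy–Hilado arXiv:2004.13228 §3.4,
§3.7, §3.9, §4.7, §4.9, §4.11–4.12. [claim: Mochizuki2012, status: disputed] for the quoted constructions;
[cite: DupuyHilado2025, §3.9, §4.7, §4.9, §4.11, §4.12]. typed ≠ proved; no side taken.
-/

noncomputable section

open Set MeasureTheory NumberField IsDedekindDomain
open scoped Pointwise

namespace Summit.ABC.IUTFork.PacketReal

open Literature.IUT.LogVolume

variable {F : Type} [Field F] [NumberField F]
variable (p : ℕ) [Fact p.Prime] (𝔽 : LocalFields F p)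

/-! ## 1. The regions at one summand `v⃗` of the real packet -/

/-- The local (Ind2)·(Ind1)-ORBIT at the summand `v⃗ = e` of (Ind3)-data `B` (one region per permuted summand
`v⃗ ∘ σ`): `⋃_{g ∈ G₂(v⃗), σ} g·perm_σ(B_{v⃗∘σ})` — verbatim the union whose hull c312-d1's `realPrimePacket_stepV`
bounds (= c312-3's `PrimePacket.localUTheta`; Dupuy–Hilado §4.11 `U_Θ = Ind2(Ind1(…))`).
[cite: DupuyHilado2025, §4.7, §4.9, §4.11] -/
def orbit {j : ℕ} (e : Fin (j + 1) → placesOver F p) (B : (realPrimePacket p 𝔽).Region) :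
    Set ((realPrimePacket p 𝔽).X j e) :=
  ⋃ (g : (realPrimePacket p 𝔽).G₂ j e) (σ : Equiv.Perm (Fin (j + 1))),
    g • ((realPrimePacket p 𝔽).perm σ e '' B j (e ∘ σ))

/-- The Θ-HULL at `v⃗`: the local holomorphic hull (`(R_I)^∼`-span, Dupuy–Hilado §4.12 "the smallest possible
module containing this regions") of the orbit — the `v⃗`-component of the hull of the union of possible images
of the Θ-pilot object ([IUTchIII] Cor. 3.12 "holomorphic hull of the union", p. 174).
[claim: Mochizuki2012, status: disputed] -/
def thetaHull {j : ℕ} (e : Fin (j + 1) → placesOver F p) (B : (realPrimePacket p 𝔽).Region) :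
    Set ((realPrimePacket p 𝔽).X j e) :=
  (realPrimePacket p 𝔽).hullLoc j e (orbit p 𝔽 e B)

/-- The PILOT REGION at `v⃗` with local value `a ∈ K_{v̲_j}^×`: `ι_j(a)·O_{v⃗}`, the region at `v⃗` of the
arithmetic line bundle with local generator `a`, twisted in through the last factor (Dupuy–Hilado §3.4
`O_𝕃(−D)`, §3.9; [IUTchIII] Rmk. 3.9.5 (ix) (cQ3) "pilot objects … arithmetic line bundles"). At `a = q̲_v` it
is the q-pilot region, at `a =` the theta value it is the bare Θ-region the (Ind3)-data sit in.
[claim: Mochizuki2012, status: disputed] -/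
def pilotRegion {j : ℕ} (e : Fin (j + 1) → placesOver F p) (a : (𝔽.k (e (Fin.last j)))ˣ) :
    Set ((realPrimePacket p 𝔽).X j e) :=
  (realPrimePacket p 𝔽).peel a '' (realPrimePacket p 𝔽).O j e

/-! ## 2. The readings of Step (xi) at the summand `v⃗` (summand-level forms of the per-packet R0, R2, R3, R4) -/

/-- **R0 at `v⃗`** (VOLUME reading; the `v⃗`-summand of c312-7's per-packet `Cor312Vol.statement_of_qLocal_le`):
the log-volume of the q-pilot region is at most the log-volume of the Θ-hull. HYPOTHESIS-shaped `Prop`, never asserted.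
[claim: Mochizuki2012, status: disputed] -/
@[claim "Mochizuki2012" "disputed"]
def VolumeReading {j : ℕ} (e : Fin (j + 1) → placesOver F p) (q : (𝔽.k (e (Fin.last j)))ˣ)
    (B : (realPrimePacket p 𝔽).Region) : Prop :=
  (realPrimePacket p 𝔽).logμ (pilotRegion p 𝔽 e q) ≤ (realPrimePacket p 𝔽).logμ (thetaHull p 𝔽 e B)

/-- **R2 at `v⃗`** (SET reading; the `v⃗`-summand of c312-7's per-packet `statement_of_qRegion_subset_thetaHull`):
the q-pilot region lies in the Θ-hull. [claim: Mochizuki2012, status: disputed] -/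
@[claim "Mochizuki2012" "disputed"]
def SubsetReading {j : ℕ} (e : Fin (j + 1) → placesOver F p) (q : (𝔽.k (e (Fin.last j)))ˣ)
    (B : (realPrimePacket p 𝔽).Region) : Prop :=
  pilotRegion p 𝔽 e q ⊆ thetaHull p 𝔽 e B

/-- **R3 at `v⃗`** (the q-pilot region lies in the union of possible images itself; the `v⃗`-summand of c312-7's
per-packet `statement_of_qRegion_mem_possibleImages`; (IPL) "two tautologically equivalent ways").
[claim: Mochizuki2012, status: disputed] -/
@[claim "Mochizuki2012" "disputed"]
def MemReading {j : ℕ} (e : Fin (j + 1) → placesOver F p) (q : (𝔽.k (e (Fin.last j)))ˣ)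
    (B : (realPrimePacket p 𝔽).Region) : Prop :=
  pilotRegion p 𝔽 e q ⊆ orbit p 𝔽 e B

/-- **R4 at `v⃗`** (Yamashita's rendering, containment UP TO ISOMORPHISM, read per packet with the isomorphism an
(Ind2)-element; tree: `Cor312ReadingIso`, skeleton XVII §7 `QIsoInHull`): some (Ind2)-translate of the q-pilot
region lies in the Θ-hull. [cite: Yamashita2024IUTSurvey, Cor. 13.13 proof p. 360]
[claim: Mochizuki2012, status: disputed] -/
@[claim "Mochizuki2012" "disputed"]
def IsoReading {j : ℕ} (e : Fin (j + 1) → placesOver F p) (q : (𝔽.k (e (Fin.last j)))ˣ)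
    (B : (realPrimePacket p 𝔽).Region) : Prop :=
  ∃ g : (realPrimePacket p 𝔽).G₂ j e, g • pilotRegion p 𝔽 e q ⊆ thetaHull p 𝔽 e B

/-- **R4′ at `v⃗`** (the tree's volume-abstracted form of Yamashita's rendering — the `v⃗`-summand of
`Cor312Vol.IsoContainment` (`Cor312ReadingIso.lean`): an admissible sub-region of the Θ-hull carrying the q-pilot
region's log-volume). [cite: Yamashita2024IUTSurvey, Cor. 13.13 proof p. 360] [claim: Mochizuki2012, status: disputed] -/
@[claim "Mochizuki2012" "disputed"]
def IsoVolReading {j : ℕ} (e : Fin (j + 1) → placesOver F p) (q : (𝔽.k (e (Fin.last j)))ˣ)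
    (B : (realPrimePacket p 𝔽).Region) : Prop :=
  ∃ R : Set ((realPrimePacket p 𝔽).X j e), R ⊆ thetaHull p 𝔽 e B ∧ (realPrimePacket p 𝔽).adm R ∧
    (realPrimePacket p 𝔽).logμ R = (realPrimePacket p 𝔽).logμ (pilotRegion p 𝔽 e q)

/-! ## 3. The pilot regions are exact -/

/-- `log μ̄_{v⃗}(ι_j(a)·O_{v⃗}) = log‖a‖` — Dupuy–Hilado (3.7) with (3.4) in the real packet (abc-iut-S2/S8).
[cite: DupuyHilado2025, §3.4, §3.7] -/
theorem logμ_pilotRegion {j : ℕ} (e : Fin (j + 1) → placesOver F p) (a : (𝔽.k (e (Fin.last j)))ˣ) :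
    (realPrimePacket p 𝔽).logμ (pilotRegion p 𝔽 e a) = Real.log ‖(a : 𝔽.k (e (Fin.last j)))‖ := by
  have h1 : pilotRegion p 𝔽 e a = iota p (fun i => 𝔽.k (e i)) (Fin.last j) (a : 𝔽.k (e (Fin.last j))) •
      (normalizedPacket p (fun i => 𝔽.k (e i)) : Set (PacketAlgebra p (fun i => 𝔽.k (e i)))) :=
    realPrimePacket_peel_image p 𝔽 a _
  show packetLogμ p (fun i => 𝔽.k (e i)) (pilotRegion p 𝔽 e a) = _
  rw [h1]
  exact packetLogμ_iota_smul_normalizedPacket p (fun i => 𝔽.k (e i)) (Fin.last j) a.ne_zero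

/-- Pilot regions are admissible (positive finite Haar measure). [cite: DupuyHilado2025, Def. 3.5.1, §3.7] -/
theorem adm_pilotRegion {j : ℕ} (e : Fin (j + 1) → placesOver F p) (a : (𝔽.k (e (Fin.last j)))ˣ) :
    (realPrimePacket p 𝔽).adm (pilotRegion p 𝔽 e a) :=
  (realPrimePacket p 𝔽).peel_adm a ((realPrimePacket p 𝔽).O_adm j e)

/-- The orbit lies in its hull. [cite: DupuyHilado2025, §4.12] -/
theorem orbit_subset_thetaHull {j : ℕ} (e : Fin (j + 1) → placesOver F p) (B : (realPrimePacket p 𝔽).Region) :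
    orbit p 𝔽 e B ⊆ thetaHull p 𝔽 e B :=
  ((realPrimePacket p 𝔽).hullLoc j e).le_closure _

/-- R4 ⟹ R4′ at `v⃗`: an (Ind2)-translate of the q-pilot region is admissible with the same `log μ̄` (Dupuy–Hilado
§4.9 "the measure of sets are preserved", the model's `logμ_smul`). [cite: DupuyHilado2025, §4.9] -/
theorem isoVolReading_of_isoReading {j : ℕ} {e : Fin (j + 1) → placesOver F p} {q : (𝔽.k (e (Fin.last j)))ˣ}
    {B : (realPrimePacket p 𝔽).Region} (h : IsoReading p 𝔽 e q B) : IsoVolReading p 𝔽 e q B := by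
  obtain ⟨g, hg⟩ := h
  exact ⟨g • pilotRegion p 𝔽 e q, hg, (realPrimePacket p 𝔽).smul_adm g (adm_pilotRegion p 𝔽 e q),
    (realPrimePacket p 𝔽).logμ_smul g (adm_pilotRegion p 𝔽 e q)⟩

/-! ## 4. The Θ-side: Step (v) per summand, unconditional -/

/-- **[IUTchIV] Thm. 1.10 Step (v) per summand, UNCONDITIONAL**: c312-d1's `realPrimePacket_stepV` with its
Prop. 1.2 (ii) hypothesis discharged by `prop12ii_holds`, rearranged — the Θ-hull at `v⃗` is admissible and
`log μ̄(Θ-hull) ≤ log‖t_{v_{i₀}}‖ + {d_I + 1}·log(p) + Σ_{i∈I*}{3 + log(e_i)}` for sharp (Ind3)-data `B` around the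
theta values `t` (`B_σ ⊆ t_{v_{σ(j)}}·O_{v⃗∘σ}`, `t_{v_j}·O_{v⃗} ⊆ B_1`), `I* ⊇` the non-tame slots, `i₀` a slot of
largest norm. [cite: Mochizuki2012, IUTchIV Thm 1.10 proof Step (v) p.27–28] -/
theorem thetaHull_bound {j : ℕ} (hj : 1 ≤ j) (e : Fin (j + 1) → placesOver F p)
    (t : ∀ v : placesOver F p, (𝔽.k v)ˣ) (B : (realPrimePacket p 𝔽).Region)
    (hB : ∀ σ : Equiv.Perm (Fin (j + 1)), B j (e ∘ σ) ⊆ pilotRegion p 𝔽 (e ∘ σ) (t (e (σ (Fin.last j)))))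
    (hB1 : pilotRegion p 𝔽 e (t (e (Fin.last j))) ⊆ B j e)
    (Istar : Finset (Fin (j + 1))) (htame : ∀ i, i ∉ Istar → absRamificationIdx p (𝔽.k (e i)) ≤ p - 2)
    (i₀ : Fin (j + 1)) (hmax : ∀ i, ‖(t (e i) : 𝔽.k (e i))‖ ≤ ‖(t (e i₀) : 𝔽.k (e i₀))‖) :
    (realPrimePacket p 𝔽).adm (thetaHull p 𝔽 e B) ∧
      (realPrimePacket p 𝔽).logμ (thetaHull p 𝔽 e B) ≤
        Real.log ‖(t (e i₀) : 𝔽.k (e i₀))‖ + (dSum p (fun i => 𝔽.k (e i)) + 1) * Real.log p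
          + ∑ i ∈ Istar, (3 + Real.log (absRamificationIdx p (𝔽.k (e i)))) := by
  obtain ⟨hadm, hvol⟩ := realPrimePacket_stepV p 𝔽 hj e (prop12ii_holds p (fun i => 𝔽.k (e i))) t B hB hB1
    Istar htame i₀ hmax
  have hadm' : (realPrimePacket p 𝔽).adm (thetaHull p 𝔽 e B) := hadm
  have hvol' : (realPrimePacket p 𝔽).logμ (thetaHull p 𝔽 e B) -
      (realPrimePacket p 𝔽).logμ (pilotRegion p 𝔽 e (t (e (Fin.last j)))) ≤
        (Real.log ‖(t (e i₀) : 𝔽.k (e i₀))‖ - Real.log ‖(t (e (Fin.last j)) : 𝔽.k (e (Fin.last j)))‖)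
          + (dSum p (fun i => 𝔽.k (e i)) + 1) * Real.log p
          + ∑ i ∈ Istar, (3 + Real.log (absRamificationIdx p (𝔽.k (e i)))) := hvol
  rw [logμ_pilotRegion] at hvol'
  exact ⟨hadm', by linarith⟩

/-! ## 5. The readings FAIL at `v⃗` once the q-value is shallower than the bound -/

section Deep

variable {p 𝔽}
variable {j : ℕ} (hj : 1 ≤ j) (e : Fin (j + 1) → placesOver F p)
  (t : ∀ v : placesOver F p, (𝔽.k v)ˣ) (B : (realPrimePacket p 𝔽).Region)
  (hB : ∀ σ : Equiv.Perm (Fin (j + 1)), B j (e ∘ σ) ⊆ pilotRegion p 𝔽 (e ∘ σ) (t (e (σ (Fin.last j)))))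
  (hB1 : pilotRegion p 𝔽 e (t (e (Fin.last j))) ⊆ B j e)
  (Istar : Finset (Fin (j + 1))) (htame : ∀ i, i ∉ Istar → absRamificationIdx p (𝔽.k (e i)) ≤ p - 2)
  (i₀ : Fin (j + 1)) (hmax : ∀ i, ‖(t (e i) : 𝔽.k (e i))‖ ≤ ‖(t (e i₀) : 𝔽.k (e i₀))‖)
  (q : (𝔽.k (e (Fin.last j)))ˣ)
  (hdeep : Real.log ‖(t (e i₀) : 𝔽.k (e i₀))‖ + (dSum p (fun i => 𝔽.k (e i)) + 1) * Real.log p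
      + ∑ i ∈ Istar, (3 + Real.log (absRamificationIdx p (𝔽.k (e i)))) <
    Real.log ‖(q : 𝔽.k (e (Fin.last j)))‖)
include hj hB hB1 htame hmax hdeep

/-- **R0 FAILS at `v⃗`.** If the q-value at `v⃗`'s last place is shallower than the shallowest theta value among
the slots by more than the [IUTchIV] Prop. 1.4 discrepancy — `log‖t_{v_{i₀}}‖ + {d_I + 1}·log(p) +
Σ_{i∈I*}{3 + log(e_i)} < log‖q̲‖` — then `log μ̄(Θ-hull at v⃗) < log μ̄(q-pilot region at v⃗)`: the volume
reading is false at this summand, for every sharp (Ind3)-datum and its whole orbit.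
[cite: Mochizuki2012, IUTchIV Thm 1.10 proof Step (v) p.27–28] -/
theorem not_volumeReading_of_deep : ¬ VolumeReading p 𝔽 e q B := by
  intro h
  have hb := (thetaHull_bound p 𝔽 hj e t B hB hB1 Istar htame i₀ hmax).2
  unfold VolumeReading at h
  rw [logμ_pilotRegion] at h
  linarith

/-- **R2 FAILS at `v⃗`** under the same hypothesis (containment would give R0 by monotonicity of `log μ̄` on
admissible regions). [cite: Mochizuki2012, IUTchIII Cor. 3.12 proof Step (xi) p.184] -/
theorem not_subsetReading_of_deep : ¬ SubsetReading p 𝔽 e q B := fun h =>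
  not_volumeReading_of_deep hj e t B hB hB1 Istar htame i₀ hmax q hdeep
    ((realPrimePacket p 𝔽).logμ_mono (adm_pilotRegion p 𝔽 e q)
      (thetaHull_bound p 𝔽 hj e t B hB hB1 Istar htame i₀ hmax).1 h)

/-- **R3 FAILS at `v⃗`** under the same hypothesis (the orbit lies in its hull).
[cite: Mochizuki2012, IUTchIII Cor. 3.12 proof Step (xi) p.184] -/
theorem not_memReading_of_deep : ¬ MemReading p 𝔽 e q B := fun h =>
  not_subsetReading_of_deep hj e t B hB hB1 Istar htame i₀ hmax q hdeep
    (h.trans (orbit_subset_thetaHull p 𝔽 e B))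

/-- **R4′ FAILS at `v⃗`** under the same hypothesis: an admissible sub-region of the Θ-hull has `log μ̄` at most
that of the hull (monotonicity), so it cannot carry the q-pilot region's log-volume.
[cite: Yamashita2024IUTSurvey, Cor. 13.13 proof p. 360] -/
theorem not_isoVolReading_of_deep : ¬ IsoVolReading p 𝔽 e q B := by
  rintro ⟨R, hR, hadm, hvol⟩
  refine not_volumeReading_of_deep hj e t B hB hB1 Istar htame i₀ hmax q hdeep ?_
  unfold VolumeReading
  rw [← hvol]
  exact (realPrimePacket p 𝔽).logμ_mono hadm (thetaHull_bound p 𝔽 hj e t B hB hB1 Istar htame i₀ hmax).1 hR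

/-- **R4 FAILS at `v⃗`** under the same hypothesis: an (Ind2)-translate of the q-pilot region has the SAME
`log μ̄` (Dupuy–Hilado §4.9 "the measure of sets are preserved" — the model's theorem `logμ_smul`) and is
admissible, so its containment in the Θ-hull would again give R0. [cite: DupuyHilado2025, §4.9] -/
theorem not_isoReading_of_deep : ¬ IsoReading p 𝔽 e q B := fun h =>
  not_isoVolReading_of_deep hj e t B hB hB1 Istar htame i₀ hmax q hdeep (isoVolReading_of_isoReading p 𝔽 h)

/-- The five summand-level readings fail TOGETHER at `v⃗` under the hypothesis. [folklore] -/
theorem readings_fail_of_deep :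
    ¬ VolumeReading p 𝔽 e q B ∧ ¬ SubsetReading p 𝔽 e q B ∧ ¬ MemReading p 𝔽 e q B ∧
      ¬ IsoReading p 𝔽 e q B ∧ ¬ IsoVolReading p 𝔽 e q B :=
  ⟨not_volumeReading_of_deep hj e t B hB hB1 Istar htame i₀ hmax q hdeep,
    not_subsetReading_of_deep hj e t B hB hB1 Istar htame i₀ hmax q hdeep,
    not_memReading_of_deep hj e t B hB hB1 Istar htame i₀ hmax q hdeep,
    not_isoReading_of_deep hj e t B hB hB1 Istar htame i₀ hmax q hdeep,
    not_isoVolReading_of_deep hj e t B hB hB1 Istar htame i₀ hmax q hdeep⟩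

end Deep

/-! ## 6. With the printed Θ-weights the hypothesis is generic -/

/-- **The Θ-weights at a diagonal summand.** At the summand `v⃗ = (v, …, v)` of degree `j ≥ 1` over ONE place
`v | p`, with theta value `t_v` and q-value `q̲` in `K_{v̲}^×` related as printed — `‖t_v‖ = ‖q̲‖^{j²}` ([IUTchI]
Ex. 3.2 (iv): `q̲_v = q_v^{1/2l}`; [IUTchIV] Thm. 1.10 Step (v) p. 28, weight `j²` — per element
"`− j²/(2l(j+1))·log(q_v)`", after the weighted average "`− j²/2l·log(q_{v_ℚ})`"; SS 2018 §2.1.8 "scaled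
by `j²`") — the five summand-level readings FAIL for every sharp (Ind3)-datum as soon as
`j²·log‖q̲‖ + {d_I + 1}·log(p) + (j + 1)·{3 + log(e(K_{v̲}))} < log‖q̲‖`, i.e. `(j² − 1)·(−log‖q̲‖) >
{d_I + 1}·log(p) + (j + 1)·{3 + log(e)}` (all slots counted in `I*`: no tameness assumed). For `j ≥ 2` the left
side grows with the `q̲`-order while the right side is a constant of the packet.
[cite: Mochizuki2012, IUTchIV Thm 1.10 proof Step (v) p.27–28] -/
theorem not_volumeReading_thetaWeights {j : ℕ} (hj : 1 ≤ j) (v : placesOver F p)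
    (t : ∀ w : placesOver F p, (𝔽.k w)ˣ) (q : (𝔽.k v)ˣ)
    (hθ : ‖(t v : 𝔽.k v)‖ = ‖(q : 𝔽.k v)‖ ^ (j ^ 2))
    (B : (realPrimePacket p 𝔽).Region)
    (hB : ∀ σ : Equiv.Perm (Fin (j + 1)),
      B j ((fun _ : Fin (j + 1) => v) ∘ σ) ⊆ pilotRegion p 𝔽 ((fun _ : Fin (j + 1) => v) ∘ σ) (t v))
    (hB1 : pilotRegion p 𝔽 (fun _ : Fin (j + 1) => v) (t v) ⊆ B j (fun _ => v))
    (hdeep : (j : ℝ) ^ 2 * Real.log ‖(q : 𝔽.k v)‖ + (dSum p (fun _ : Fin (j + 1) => 𝔽.k v) + 1) * Real.log p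
        + (j + 1) * (3 + Real.log (absRamificationIdx p (𝔽.k v))) < Real.log ‖(q : 𝔽.k v)‖) :
    ¬ VolumeReading p 𝔽 (fun _ : Fin (j + 1) => v) q B ∧
      ¬ SubsetReading p 𝔽 (fun _ : Fin (j + 1) => v) q B ∧
      ¬ MemReading p 𝔽 (fun _ : Fin (j + 1) => v) q B ∧
      ¬ IsoReading p 𝔽 (fun _ : Fin (j + 1) => v) q B ∧
      ¬ IsoVolReading p 𝔽 (fun _ : Fin (j + 1) => v) q B := by
  have hlog : Real.log ‖(t v : 𝔽.k v)‖ = (j : ℝ) ^ 2 * Real.log ‖(q : 𝔽.k v)‖ := by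
    rw [hθ, Real.log_pow]
    push_cast
    ring
  have hsum : (∑ _i ∈ (Finset.univ : Finset (Fin (j + 1))),
      (3 + Real.log (absRamificationIdx p (𝔽.k v)) : ℝ)) =
      (j + 1) * (3 + Real.log (absRamificationIdx p (𝔽.k v))) := by
    simp only [Finset.sum_const, Finset.card_univ, Fintype.card_fin, nsmul_eq_mul]
    push_cast
    ring
  have key : Real.log ‖(t v : 𝔽.k v)‖ + (dSum p (fun _ : Fin (j + 1) => 𝔽.k v) + 1) * Real.log p
      + ∑ _i ∈ (Finset.univ : Finset (Fin (j + 1))), (3 + Real.log (absRamificationIdx p (𝔽.k v)) : ℝ) <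
    Real.log ‖(q : 𝔽.k v)‖ := by
    rw [hlog, hsum]
    exact hdeep
  exact readings_fail_of_deep hj (fun _ => v) t B hB hB1 Finset.univ
    (fun i hi => absurd (Finset.mem_univ i) hi) (Fin.last j) (fun _ => le_rfl) q key

/-! ## 7. Non-vacuity: the hypotheses are jointly satisfiable in every real packet -/

/-- **NON-VACUITY.** At every place `v | p`, for every label `j ≥ 2`, the hypotheses of
`not_volumeReading_thetaWeights` are jointly satisfiable in the real packet: theta values `t_w := p^{N·j²}`,
q-value `q̲ := p^N` (so `‖t_v‖ = ‖q̲‖^{j²}`), (Ind3)-data `B :=` the bare Θ-regions themselves, and `N` large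
(archimedean property; `(j² − 1)·log(p) > 0`). So the five summand-level readings are REFUTED, not merely
unprovable, at explicit data of every real packet — while nothing is claimed about the regions attached to
given initial Θ-data ([IUTchI] Def. 3.1), whose `q̲_v`-orders are what they are. [folklore] -/
theorem thetaWeights_hypotheses_satisfiable {j : ℕ} (hj : 2 ≤ j) (v : placesOver F p) :
    ∃ (t : ∀ w : placesOver F p, (𝔽.k w)ˣ) (q : (𝔽.k v)ˣ) (B : (realPrimePacket p 𝔽).Region),
      ‖(t v : 𝔽.k v)‖ = ‖(q : 𝔽.k v)‖ ^ (j ^ 2) ∧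
      (∀ σ : Equiv.Perm (Fin (j + 1)),
        B j ((fun _ : Fin (j + 1) => v) ∘ σ) ⊆ pilotRegion p 𝔽 ((fun _ : Fin (j + 1) => v) ∘ σ) (t v)) ∧
      pilotRegion p 𝔽 (fun _ : Fin (j + 1) => v) (t v) ⊆ B j (fun _ => v) ∧
      (j : ℝ) ^ 2 * Real.log ‖(q : 𝔽.k v)‖ + (dSum p (fun _ : Fin (j + 1) => 𝔽.k v) + 1) * Real.log p
        + (j + 1) * (3 + Real.log (absRamificationIdx p (𝔽.k v))) < Real.log ‖(q : 𝔽.k v)‖ := by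
  have hp1 : (1 : ℝ) < p := by exact_mod_cast (Fact.out : p.Prime).one_lt
  have hlogp : 0 < Real.log p := Real.log_pos hp1
  have hj2 : (0 : ℝ) < (j : ℝ) ^ 2 - 1 := by
    have h2 : (2 : ℝ) ≤ j := by exact_mod_cast hj
    nlinarith
  have hD : 0 < ((j : ℝ) ^ 2 - 1) * Real.log p := mul_pos hj2 hlogp
  obtain ⟨N, hN⟩ := exists_nat_gt
    (((dSum p (fun _ : Fin (j + 1) => 𝔽.k v) + 1) * Real.log p
        + (j + 1) * (3 + Real.log (absRamificationIdx p (𝔽.k v)))) / (((j : ℝ) ^ 2 - 1) * Real.log p))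
  have hcN := (div_lt_iff₀ hD).mp hN
  refine ⟨fun w => primeUnit p (𝔽.k w) ^ (N * j ^ 2), primeUnit p (𝔽.k v) ^ N,
    fun j' e' => pilotRegion p 𝔽 e' (primeUnit p (𝔽.k (e' (Fin.last j'))) ^ (N * j' ^ 2)), ?_, ?_, ?_, ?_⟩
  · simp only [Units.val_pow_eq_pow_val, coe_primeUnit, norm_pow, pow_mul]
  · intro σ
    exact Subset.rfl
  · exact Subset.rfl
  · have hq : Real.log ‖((primeUnit p (𝔽.k v) ^ N : (𝔽.k v)ˣ) : 𝔽.k v)‖ = -(N * Real.log p) := by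
      rw [Units.val_pow_eq_pow_val, coe_primeUnit, norm_pow, norm_prime p (𝔽.k v), Real.log_pow,
        Real.log_inv]
      ring
    rw [hq]
    nlinarith [hcN, hlogp]

end Summit.ABC.IUTFork.PacketReal

end
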